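import Summits.AtomisticToContinuum.BoseEinsteinCondensation.Theorems.BECInsertionCorrectorStaticResponseBoundWindowAssembly
import Summits.AtomisticToContinuum.BoseEinsteinCondensation.Theorems.BECInsertionCorrectorStaticResponseBoundSectorCauchySchwarz
import Summits.AtomisticToContinuum.BoseEinsteinCondensation.Theorems.BECInsertionCorrectorStaticResponseBoundSectorDecomposition
import Summits.AtomisticToContinuum.BoseEinsteinCondensation.Theorems.BECInsertionCorrectorStaticResponseBoundUvComposition
import Summits.AtomisticToContinuum.BoseEinsteinCondensation.Theorems.BECInsertionCorrectorStaticResponseBoundTruncationCompactness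
import Summits.AtomisticToContinuum.BoseEinsteinCondensation.Theorems.BECInsertionCorrectorStaticResponseBoundMaxFormBoundHolds
import HarnessLib

/-!
# Crux `StaticResponseBound` (stmt-AtomisticToContinuum-12057): the three LEAVES, in the tree

Helper file (supports, does not close, the crux item; crux-strategist census 2026-08-17, `Cruxes/StaticResponseBound/STRATEGY-CENSUS.md`).
Six lead seats and four planner lines on this crux converged on ONE kernel-checked reduction of the crux to three
thermodynamic-limit statements, each of independent content, plus two classical debts (one of which, `MaxFormBound`, is
paid: `FewBody.stub_maxFormBound`, p118247).  The reduction itself so far lived only inside the skeleton work-files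
`Cruxes/StaticResponseBound/Lines/*.lean` (which carry `sorry`s and are not importable).  This file lands it as a theorem
of the tree over the LANDED pieces only, so that the decomposition

  `StaticResponseBound ⟸ EnergyControlledStructureFactor ∧ SectorFloor ∧ UvCurvatureBound`

is citable by name (`staticResponseBound_of_leaves`, hypotheses = the three leaf texts) and can be filed as a route-level split by one command if the planners so
decide.  The three leaves (texts verbatim the registered stubs; spelled out in the theorem statements below, no new `def`s):

* `EnergyControlledStructureFactor` (ECSF; line `stable-fraction-square-completion`, stub `stub_energyControlledStructureFactor`):
  energy-controlled structure factor on the infrared window `|p|² ≤ M₀²ρa`, all `N ≥ 1`, all finite-energy states — a strengthened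
  hyperuniformity (it implies `TorusHyperuniformity`, stmt-9093: `torusHyperuniformity_of_ecsf`, p89652).
* `SectorFloor` (stub `stub_sectorFloor`): Landau floor with saturation, all `N ≥ 1` — a strengthened `LandauSectorBound`
  (stmt-9091: `landauSectorBound_of_sectorFloor`, p89438).
* `UvCurvatureBound` (line `uv-thomson-force-wave`, seat c1, stub `stub_uvCurvatureBound`): `N`-uniform curvature of the modulated
  ground-state energy `s ↦ E₀(H + s∑cos(p·xⱼ))` (truncated potentials) on the ultraviolet window `Λρa ≤ |p|²`.

Glue used (all landed): `stub_windowAssembly` (p87701), `stub_sectorCauchySchwarz` (p87427), `stub_sectorDecomposition` (p85983),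
`UvThomsonForceWave.staticResponseBound_of_halves` (p107151), `stub_truncationLimit_of_maxFormBound` (p77117),
`FewBody.stub_maxFormBound` (p118247).  No new mathematics: this is bookkeeping that makes the census's `## Decomposition` executable.
-/

noncomputable section

namespace Summit.AtomisticToContinuum.BoseEinsteinCondensation.Cruxes.StaticResponseBound.Leaves

open MeasureTheory Filter
open scoped ENNReal NNReal BigOperators Topology InnerProductSpace
open Literature.MathematicalPhysics.QuantumManyBody.BoseGas
open Summit.AtomisticToContinuum.BoseEinsteinCondensation.Theses
open Summit.AtomisticToContinuum.BoseEinsteinCondensation.Theses.BECInsertionCorrector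
open Summit.AtomisticToContinuum.BoseEinsteinCondensation.Theorems.StaticResponseBound.Negative
open Summit.AtomisticToContinuum.BoseEinsteinCondensation.Cruxes.StaticResponseBound

/-! ### The glue (all over landed theorems; statements spelled out, no new definitions)

Leaf texts: (ECSF) = hypothesis 1 of `StableFractionSquareCompletion.stub_windowAssembly` = registered `stub_energyControlledStructureFactor`;
(SectorFloor) = hypothesis 2 of the same = registered `stub_sectorFloor`; (UvCurvatureBound) = hypothesis 3 of
`UvThomsonForceWave.staticResponseBound_of_halves` = registered `stub_uvCurvatureBound`; (InfraredHalf) = registered `stub_infraredHalf`. -/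

/-- **IR half from the two infrared leaves**: (ECSF) → (SectorFloor) → (InfraredHalf) — sector decomposition (p85983),
sector Cauchy–Schwarz (p87427), window assembly (p87701). [folklore] -/
theorem infraredHalf_of_ecsf_of_sectorFloor :
    (∀ v : ℝ → ℝ≥0∞, IsRepulsiveFiniteRange v → ∀ M₀ : ℝ, 0 < M₀ →
        ∃ ρ₀ : ℝ, 0 < ρ₀ ∧ ∃ θ : ℝ, 0 < θ ∧ ∃ C_H : ℝ, 0 ≤ C_H ∧
          ∀ ρ : ℝ, 0 < ρ → ρ < ρ₀ → ∀ N : ℕ, 0 < N → ∀ k : Fin 3 → ℤ, k ≠ 0 →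
            psq (sideLength ρ N) k ≤ M₀ ^ 2 * (ρ * (scatteringLength v).toReal) →
            ∀ Φ : PeriodicTrialState N (sideLength ρ N), periodicEnergy v Φ ≠ ⊤ →
              θ * (8 * Real.pi * (scatteringLength v).toReal + psq (sideLength ρ N) k / (2 * ρ)) /
                  sideLength ρ N ^ 3 *
                  (∫ X in cellN N (sideLength ρ N),
                    ‖densityWave N (sideLength ρ N) k X‖ ^ 2 * ‖Φ.ψ X‖ ^ 2) ≤
                (periodicEnergy v Φ).toReal - (periodicGroundStateEnergy v N (sideLength ρ N)).toReal +
                  θ * (8 * Real.pi * (scatteringLength v).toReal + psq (sideLength ρ N) k / (2 * ρ)) /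
                    sideLength ρ N ^ 3 *
                    (C_H * N * Real.sqrt (psq (sideLength ρ N) k) /
                      Real.sqrt (ρ * (scatteringLength v).toReal))) →
    (∀ v : ℝ → ℝ≥0∞, IsRepulsiveFiniteRange v → ∀ M₀ : ℝ, 0 < M₀ →
        ∃ θL : ℝ, 0 < θL ∧ ∃ ρ₀ : ℝ, 0 < ρ₀ ∧ ∀ ρ : ℝ, 0 < ρ → ρ < ρ₀ → ∀ N : ℕ, 0 < N →
          ∀ m : Fin 3 → ℤ, m ≠ 0 →
            periodicGroundStateEnergy v N (sideLength ρ N)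
                + ENNReal.ofReal (θL * Real.sqrt (ρ * (scatteringLength v).toReal)
                    * min (Real.sqrt (psq (sideLength ρ N) m))
                          (M₀ * Real.sqrt (ρ * (scatteringLength v).toReal)))
              ≤ momentumSectorEnergy v N (sideLength ρ N)
                  ((2 * Real.pi / sideLength ρ N) •
                    (WithLp.toLp 2 fun t => (m t : ℝ) : EuclideanSpace ℝ (Fin 3)))) →
    (∀ v : ℝ → ℝ≥0∞, IsRepulsiveFiniteRange v → ∀ M₀ : ℝ, 0 < M₀ →
        ∃ ρ₀ : ℝ, 0 < ρ₀ ∧ ∃ C : ℝ, 0 < C ∧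
          ∀ ρ : ℝ, 0 < ρ → ρ < ρ₀ → ∀ N : ℕ, 0 < N → ∀ k : Fin 3 → ℤ, k ≠ 0 →
            psq (sideLength ρ N) k ≤ M₀ ^ 2 * (ρ * (scatteringLength v).toReal) →
            ∀ t : ℝ, ∀ Ψ : PeriodicTrialState N (sideLength ρ N), periodicEnergy v Ψ ≠ ⊤ →
              Ineq v C ρ N k t Ψ) := fun hE hB =>
  StableFractionSquareCompletion.stub_windowAssembly hE hB
    (StableFractionSquareCompletion.stub_sectorCauchySchwarz StableFractionSquareCompletion.stub_sectorDecomposition)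

/-- **The truncation limit `E₀(min(v,n),N,L) ↑ E₀(v,N,L)` holds unconditionally** for every admissible `v` (classical debt
`MaxFormBound` paid: p118247 + the reduction p77117). [folklore] -/
theorem truncationLimit_holds :
    (∀ v : ℝ → ℝ≥0∞, IsRepulsiveFiniteRange v → ∀ (N : ℕ) (L : ℝ), 0 < L →
        periodicGroundStateEnergy v N L ≠ ⊤ →
        ∀ ε : ℝ, 0 < ε → ∃ n₁ : ℕ, ∀ n : ℕ, n₁ ≤ n →
          (periodicGroundStateEnergy v N L).toReal ≤
            (periodicGroundStateEnergy (truncPotential v n) N L).toReal + ε) :=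
  UvThomsonForceWave.stub_truncationLimit_of_maxFormBound FewBody.stub_maxFormBound

/-- **Two-leaf form**: the crux BY NAME from its infrared half and the UV curvature bound (p107151 + the paid debt). [folklore] -/
theorem staticResponseBound_of_infraredHalf_of_uvCurvature :
    (∀ v : ℝ → ℝ≥0∞, IsRepulsiveFiniteRange v → ∀ M₀ : ℝ, 0 < M₀ →
        ∃ ρ₀ : ℝ, 0 < ρ₀ ∧ ∃ C : ℝ, 0 < C ∧
          ∀ ρ : ℝ, 0 < ρ → ρ < ρ₀ → ∀ N : ℕ, 0 < N → ∀ k : Fin 3 → ℤ, k ≠ 0 →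
            psq (sideLength ρ N) k ≤ M₀ ^ 2 * (ρ * (scatteringLength v).toReal) →
            ∀ t : ℝ, ∀ Ψ : PeriodicTrialState N (sideLength ρ N), periodicEnergy v Ψ ≠ ⊤ →
              Ineq v C ρ N k t Ψ) →
    (∀ v : ℝ → ℝ≥0∞, IsRepulsiveFiniteRange v →
        ∃ Λ : ℝ, 1 ≤ Λ ∧ ∃ ρ₁ : ℝ, 0 < ρ₁ ∧ ∃ K : ℝ, 0 ≤ K ∧ ∃ n₀ : ℕ, ∀ n : ℕ, n₀ ≤ n →
          ∀ ρ : ℝ, 0 < ρ → ρ < ρ₁ → ∀ N : ℕ, 1 ≤ N → ∀ k : Fin 3 → ℤ, k ≠ 0 →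
            Λ * (ρ * (scatteringLength v).toReal) ≤ psq (sideLength ρ N) k →
            ∀ s : ℝ, s ^ 2 ≤ psq (sideLength ρ N) k *
                (periodicGroundStateEnergy (truncPotential v n) N (sideLength ρ N)).toReal / N →
            ∀ ε : ℝ, 0 < ε → ∃ δ₀ : ℝ, 0 < δ₀ ∧ ∀ δ : ℝ, 0 < δ → δ < δ₀ →
              -(2 * (K * N / psq (sideLength ρ N) k + ε) * δ ^ 2) ≤
                (⨅ Ψ : {Ψ : PeriodicTrialState N (sideLength ρ N) // periodicEnergy (truncPotential v n) Ψ ≠ ⊤},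
                    ((periodicEnergy (truncPotential v n) Ψ.1).toReal +
                      (s + δ) * cosMean (sideLength ρ N) k Ψ.1)) +
                (⨅ Ψ : {Ψ : PeriodicTrialState N (sideLength ρ N) // periodicEnergy (truncPotential v n) Ψ ≠ ⊤},
                    ((periodicEnergy (truncPotential v n) Ψ.1).toReal +
                      (s - δ) * cosMean (sideLength ρ N) k Ψ.1)) -
                2 * (⨅ Ψ : {Ψ : PeriodicTrialState N (sideLength ρ N) // periodicEnergy (truncPotential v n) Ψ ≠ ⊤},
                    ((periodicEnergy (truncPotential v n) Ψ.1).toReal +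
                      s * cosMean (sideLength ρ N) k Ψ.1))) →
    StaticResponseBound := fun h₁ h₅ =>
  UvThomsonForceWave.staticResponseBound_of_halves h₁ truncationLimit_holds h₅

/-- **The decomposition of the crux into its three leaves**: (ECSF) → (SectorFloor) → (UvCurvatureBound) → `StaticResponseBound`
(the crux decl of route BECInsertionCorrector BY NAME; the BECBathMassLiouville decl is the same term,
`Negative.staticResponseBound_routes_agree`). [folklore] -/
theorem staticResponseBound_of_leaves :
    (∀ v : ℝ → ℝ≥0∞, IsRepulsiveFiniteRange v → ∀ M₀ : ℝ, 0 < M₀ →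
        ∃ ρ₀ : ℝ, 0 < ρ₀ ∧ ∃ θ : ℝ, 0 < θ ∧ ∃ C_H : ℝ, 0 ≤ C_H ∧
          ∀ ρ : ℝ, 0 < ρ → ρ < ρ₀ → ∀ N : ℕ, 0 < N → ∀ k : Fin 3 → ℤ, k ≠ 0 →
            psq (sideLength ρ N) k ≤ M₀ ^ 2 * (ρ * (scatteringLength v).toReal) →
            ∀ Φ : PeriodicTrialState N (sideLength ρ N), periodicEnergy v Φ ≠ ⊤ →
              θ * (8 * Real.pi * (scatteringLength v).toReal + psq (sideLength ρ N) k / (2 * ρ)) /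
                  sideLength ρ N ^ 3 *
                  (∫ X in cellN N (sideLength ρ N),
                    ‖densityWave N (sideLength ρ N) k X‖ ^ 2 * ‖Φ.ψ X‖ ^ 2) ≤
                (periodicEnergy v Φ).toReal - (periodicGroundStateEnergy v N (sideLength ρ N)).toReal +
                  θ * (8 * Real.pi * (scatteringLength v).toReal + psq (sideLength ρ N) k / (2 * ρ)) /
                    sideLength ρ N ^ 3 *
                    (C_H * N * Real.sqrt (psq (sideLength ρ N) k) /
                      Real.sqrt (ρ * (scatteringLength v).toReal))) →
    (∀ v : ℝ → ℝ≥0∞, IsRepulsiveFiniteRange v → ∀ M₀ : ℝ, 0 < M₀ →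
        ∃ θL : ℝ, 0 < θL ∧ ∃ ρ₀ : ℝ, 0 < ρ₀ ∧ ∀ ρ : ℝ, 0 < ρ → ρ < ρ₀ → ∀ N : ℕ, 0 < N →
          ∀ m : Fin 3 → ℤ, m ≠ 0 →
            periodicGroundStateEnergy v N (sideLength ρ N)
                + ENNReal.ofReal (θL * Real.sqrt (ρ * (scatteringLength v).toReal)
                    * min (Real.sqrt (psq (sideLength ρ N) m))
                          (M₀ * Real.sqrt (ρ * (scatteringLength v).toReal)))
              ≤ momentumSectorEnergy v N (sideLength ρ N)
                  ((2 * Real.pi / sideLength ρ N) •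
                    (WithLp.toLp 2 fun t => (m t : ℝ) : EuclideanSpace ℝ (Fin 3)))) →
    (∀ v : ℝ → ℝ≥0∞, IsRepulsiveFiniteRange v →
        ∃ Λ : ℝ, 1 ≤ Λ ∧ ∃ ρ₁ : ℝ, 0 < ρ₁ ∧ ∃ K : ℝ, 0 ≤ K ∧ ∃ n₀ : ℕ, ∀ n : ℕ, n₀ ≤ n →
          ∀ ρ : ℝ, 0 < ρ → ρ < ρ₁ → ∀ N : ℕ, 1 ≤ N → ∀ k : Fin 3 → ℤ, k ≠ 0 →
            Λ * (ρ * (scatteringLength v).toReal) ≤ psq (sideLength ρ N) k →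
            ∀ s : ℝ, s ^ 2 ≤ psq (sideLength ρ N) k *
                (periodicGroundStateEnergy (truncPotential v n) N (sideLength ρ N)).toReal / N →
            ∀ ε : ℝ, 0 < ε → ∃ δ₀ : ℝ, 0 < δ₀ ∧ ∀ δ : ℝ, 0 < δ → δ < δ₀ →
              -(2 * (K * N / psq (sideLength ρ N) k + ε) * δ ^ 2) ≤
                (⨅ Ψ : {Ψ : PeriodicTrialState N (sideLength ρ N) // periodicEnergy (truncPotential v n) Ψ ≠ ⊤},
                    ((periodicEnergy (truncPotential v n) Ψ.1).toReal +
                      (s + δ) * cosMean (sideLength ρ N) k Ψ.1)) +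
                (⨅ Ψ : {Ψ : PeriodicTrialState N (sideLength ρ N) // periodicEnergy (truncPotential v n) Ψ ≠ ⊤},
                    ((periodicEnergy (truncPotential v n) Ψ.1).toReal +
                      (s - δ) * cosMean (sideLength ρ N) k Ψ.1)) -
                2 * (⨅ Ψ : {Ψ : PeriodicTrialState N (sideLength ρ N) // periodicEnergy (truncPotential v n) Ψ ≠ ⊤},
                    ((periodicEnergy (truncPotential v n) Ψ.1).toReal +
                      s * cosMean (sideLength ρ N) k Ψ.1))) →
    StaticResponseBound := fun hE hB hU =>
  staticResponseBound_of_infraredHalf_of_uvCurvature (infraredHalf_of_ecsf_of_sectorFloor hE hB) hU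

end Summit.AtomisticToContinuum.BoseEinsteinCondensation.Cruxes.StaticResponseBound.Leaves

end
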